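import Summits.ResolutionOfSingularities.ResolutionOfSingularities.Theorems.FrobeniusClosingPatchingRelPerfectDepthMultiHostResidual
import HarnessLib

/-!
# Crux `PatchingRelPerfect` (stmt-ResolutionOfSingularities-16161), chain W5.2 — F7(β) (β-AX) X3 C-I «ONE GLOBAL CARRIER»:
# F-bare — a BARE host (residual exponents all zero) STAYS BARE under a step whose weight data are minimal at it

[OURS · L1 W5.2 · F7(β) (β-AX) X3 C-I · res-L1-w52-plan-1 NOTE G11-47 (1) naming «F-bare `MultiHostState.residual_bare_step`: a host with
`residualExps = 0` keeps `residualExps = 0` after `S.step … 1 …` with centre ⊆ cosupp S.residual.K» · res-L1-w52-idea-1 X3 memo-3 (1) «one global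
carrier, all stages»] res-L1-w52-stub-1 g5.  Replaces the role of NO printed item; NOT a statement of the manuscript under review (AI-written,
weaker than expert review).  Over res-L1-repro-3's `…DepthMultiHostResidual` (`expAt`, `minExpAt`, `minExps`, `residualExps`, `residual`) and
pv-021's `MultiHostState.step` (p540590), def-free:

* §1 exponent bookkeeping of a step: `length_exps` (every exponent list has the length of `𝓔`), `step_expAt_of_lt` (old positions keep their
  exponents), `step_expAt_length` (the new member carries `m i + weightAt (exps i) η − ν`), `step_expAt_of_gt`;
* §2 «BARE» := row `i₀` is the member-wise minimum, `∀ j, S.expAt i₀ j = S.minExpAt j` (⟺ `residualExps i₀` has only zero exponents,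
  `bare_iff_residualExps`); **`step_bare`** — bareness is preserved by ANY step (`ν` arbitrary) whose new exponent is minimal at `i₀`:
  `∀ i, m i₀ + weightAt (S.exps i₀) η ≤ m i + weightAt (S.exps i) η`;
* §3 weights split along `K = M · K♭`: `weightAt_exps_eq_add` (`weightAt (exps i) η = weightAt minExps η + weightAt (residualExps i) η`),
  `weightAt_residualExps_eq_zero_of_bare`; hence **`residual_bare_step`** — with `ν = 1`, `m i₀ = 1` and the residual weight hypothesis
  `∀ i, 1 ≤ m i + weightAt (S.residualExps i) η` (= the step law's `hν` for the RESIDUAL state, i.e. legality w.r.t. `cosupp K♭` read at the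
  generic point of the centre) the bare host stays bare.

Fact-free.  Consumers: C-I (`PhaseCOne`, res-L1-w52-lead-1 Atlas), idea-1's carrier analysis (Lemma R at every stage).

## References
* E. Bierstone, D. Grigoriev, P. Milman, J. Włodarczyk (2011), §4 Step 2b (the monomial part and its weights). [BierstoneGrigorievMilmanWlodarczyk2011]
* J. Kollár, *Lectures on Resolution of Singularities* (2007), (3.111) Step 3. [Kollar2007]
-/

-- `Summit.<Summit>.<Sub>.Theorems` with `Sub = Summit` (single-conjunct summit, D-0017)
set_option linter.dupNamespace false

noncomputable section

open CategoryTheory AlgebraicGeometry TopologicalSpace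
open Literature.AlgebraicGeometry.Resolution
open Scheme.IdealSheafData

namespace Summit.ResolutionOfSingularities.ResolutionOfSingularities.Theorems.DepthMultiHost

universe u

/-! ## §0 Weights of position-wise re-exponentiated lists -/

section Weights

variable {X : Scheme.{u}}

/-- **Weights are additive under the position-wise factor law**: for `μ_j ≤ e_j`, `weightAt E x = weightAt [(T_j, μ_j)] x +
weightAt [(T_j, e_j − μ_j)] x`. [cite: BierstoneGrigorievMilmanWlodarczyk2011, §4 Step 2b] -/
theorem weightAt_eq_add_of_le (E : List (X.IdealSheafData × ℕ)) (μ : ℕ → ℕ) (hμ : ∀ j : ℕ, μ j ≤ (E.map Prod.snd).getD j 0) (x : X) :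
    weightAt E x = weightAt (E.mapIdx fun j p => (p.1, μ j)) x + weightAt (E.mapIdx fun j p => (p.1, p.2 - μ j)) x := by
  classical
  induction E generalizing μ with
  | nil => simp
  | cons p E ih =>
    have h0 : μ 0 ≤ p.2 := by simpa using hμ 0
    have ih' := ih (fun j => μ (j + 1)) fun j => by simpa using hμ (j + 1)
    simp only [List.mapIdx_cons, weightAt_cons]
    rw [ih']
    by_cases hx : x ∈ p.1.support
    · rw [if_pos hx, if_pos hx, if_pos hx]
      have := Nat.add_sub_cancel' h0
      omega
    · rw [if_neg hx, if_neg hx, if_neg hx]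
      omega

/-- A list all of whose exponents vanish has weight zero everywhere. [folklore] -/
theorem weightAt_eq_zero_of_forall_snd_eq_zero (E : List (X.IdealSheafData × ℕ)) (h : ∀ p ∈ E, p.2 = 0) (x : X) : weightAt E x = 0 := by
  classical
  induction E with
  | nil => simp
  | cons p E ih =>
    rw [weightAt_cons, ih fun q hq => h q (List.mem_cons_of_mem _ hq), h p (List.mem_cons_self ..)]
    split_ifs <;> rfl

end Weights

namespace MultiHostState

variable {X X' : Scheme.{u}} (S : MultiHostState X)

/-! ## §1 Exponent bookkeeping of a step -/

/-- Every exponent list has the length of the member family. [folklore] -/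
theorem length_exps (i : Fin S.n) : (S.exps i).length = S.𝓔.length := by
  have h := congrArg List.length (S.boundaryOf_exps i)
  rwa [boundaryOf, List.length_map] at h

/-- The exponent at a position only depends on the list of exponents. [folklore] -/
theorem expAt_eq (i : Fin S.n) (j : ℕ) : S.expAt i j = (((S.exps i).map Prod.snd)[j]?).getD 0 := by
  rw [expAt, List.getD_eq_getElem?_getD]

/-! ## §2 Bare hosts stay bare -/

/-- «BARE» read on the residual exponent list: row `i₀` is the member-wise minimum iff `residualExps i₀` has only zero exponents.
[folklore] -/
theorem bare_iff_residualExps (i₀ : Fin S.n) :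
    (∀ j, S.expAt i₀ j = S.minExpAt j) ↔ ∀ p ∈ S.residualExps i₀, p.2 = 0 := by
  constructor
  · intro h p hp
    rw [residualExps] at hp
    obtain ⟨j, q, hq, rfl⟩ : ∃ j q, (S.exps i₀)[j]? = some q ∧ (q.1, q.2 - S.minExpAt j) = p := by
      obtain ⟨j, hj, hjp⟩ := List.mem_iff_getElem.mp hp
      refine ⟨j, (S.exps i₀)[j]'(by rw [List.length_mapIdx] at hj; exact hj), List.getElem?_eq_getElem _, ?_⟩
      rw [← hjp, List.getElem_mapIdx]
    have hx : S.expAt i₀ j = q.2 := by rw [expAt_eq, List.getElem?_map, hq]; rfl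
    show q.2 - S.minExpAt j = 0
    rw [← h j, hx, Nat.sub_self]
  · intro h j
    refine le_antisymm ?_ (S.minExpAt_le i₀ j)
    rcases hq : (S.exps i₀)[j]? with _ | q
    · rw [expAt_eq, List.getElem?_map, hq]
      exact Nat.zero_le _
    · have hmem : (q.1, q.2 - S.minExpAt j) ∈ S.residualExps i₀ := by
        rw [residualExps, List.mem_iff_getElem?]
        exact ⟨j, by rw [List.getElem?_mapIdx, hq]; rfl⟩
      have h0 : q.2 - S.minExpAt j = 0 := h _ hmem
      have hx : S.expAt i₀ j = q.2 := by rw [expAt_eq, List.getElem?_map, hq]; rfl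
      rw [hx]
      omega


section Step

variable [IsLocallyNoetherian X] (τ : X' ⟶ X) (W : Closeds X) (η : X) (m : Fin S.n → ℕ) (ν : ℕ)
  (hsnc : HasSNCWith S.𝓔 (vanishingIdeal W)) (hτ : IsBlowup τ (vanishingIdeal W))

/-- The exponents of the stepped state, as a list of numbers: the old exponents followed by the new one. [folklore] -/
theorem step_exps_map_snd (i : Fin S.n) :
    ((S.step τ W η m ν hsnc hτ).exps i).map Prod.snd = (S.exps i).map Prod.snd ++ [m i + weightAt (S.exps i) η - ν] := by
  rw [step_exps, List.map_append, List.map_map, List.map_singleton]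
  rfl

/-- **Old positions keep their exponents.** [folklore] -/
theorem step_expAt_of_lt (i : Fin S.n) {j : ℕ} (hj : j < S.𝓔.length) : (S.step τ W η m ν hsnc hτ).expAt i j = S.expAt i j := by
  have hj' : j < ((S.exps i).map Prod.snd).length := by rw [List.length_map, S.length_exps i]; exact hj
  rw [expAt_eq, expAt_eq, step_exps_map_snd, List.getElem?_append_left hj']

/-- **The new member carries `m i + weightAt (exps i) η − ν`.** [cite: BierstoneGrigorievMilmanWlodarczyk2011, §4 Step 2b] -/
theorem step_expAt_length (i : Fin S.n) : (S.step τ W η m ν hsnc hτ).expAt i S.𝓔.length = m i + weightAt (S.exps i) η - ν := by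
  have hl : ((S.exps i).map Prod.snd).length = S.𝓔.length := by rw [List.length_map, S.length_exps i]
  rw [expAt_eq, step_exps_map_snd, List.getElem?_append_right (le_of_eq hl), hl, Nat.sub_self]
  rfl

/-- Past the new member there is nothing. [folklore] -/
theorem step_expAt_of_gt (i : Fin S.n) {j : ℕ} (hj : S.𝓔.length < j) : (S.step τ W η m ν hsnc hτ).expAt i j = 0 := by
  rw [expAt_eq, step_exps_map_snd, List.getElem?_eq_none]
  · rfl
  · rw [List.length_append, List.length_map, S.length_exps i, List.length_singleton]
    exact hj

/-- [OURS · L1 W5.2 · X3 C-I] **A bare host stays bare** under any step whose new exponent is MINIMAL at it: if row `i₀` is the member-wise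
minimum of `S` and `m i₀ + weightAt (exps i₀) η ≤ m i + weightAt (exps i) η` for every summand `i`, then row `i₀` is the member-wise
minimum of `S.step τ W η m ν`. [cite: BierstoneGrigorievMilmanWlodarczyk2011, §4 Step 2b] -/
theorem step_bare {i₀ : Fin S.n} (hbare : ∀ j, S.expAt i₀ j = S.minExpAt j)
    (hmin : ∀ i, m i₀ + weightAt (S.exps i₀) η ≤ m i + weightAt (S.exps i) η) (j : ℕ) :
    (S.step τ W η m ν hsnc hτ).expAt i₀ j = (S.step τ W η m ν hsnc hτ).minExpAt j := by
  haveI : Nonempty (Fin (S.step τ W η m ν hsnc hτ).n) := ⟨i₀⟩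
  refine le_antisymm ?_ ((S.step τ W η m ν hsnc hτ).minExpAt_le i₀ j)
  refine le_ciInf fun i => ?_
  change (S.step τ W η m ν hsnc hτ).expAt i₀ j ≤ (S.step τ W η m ν hsnc hτ).expAt i j
  rcases lt_trichotomy j S.𝓔.length with hj | rfl | hj
  · rw [S.step_expAt_of_lt τ W η m ν hsnc hτ i₀ hj, S.step_expAt_of_lt τ W η m ν hsnc hτ i hj, hbare j]
    exact S.minExpAt_le i j
  · rw [S.step_expAt_length τ W η m ν hsnc hτ i₀, S.step_expAt_length τ W η m ν hsnc hτ i]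
    exact Nat.sub_le_sub_right (hmin i) ν
  · rw [S.step_expAt_of_gt τ W η m ν hsnc hτ i₀ hj]
    exact Nat.zero_le _

end Step

/-! ## §3 Weights along `K = M · K♭` and the residual form of F-bare -/

/-- **`weightAt (exps i) η = weightAt M η + weightAt (residualExps i) η`.** [cite: BierstoneGrigorievMilmanWlodarczyk2011, §4 Step 2b] -/
theorem weightAt_exps_eq_add (i : Fin S.n) (x : X) :
    weightAt (S.exps i) x = weightAt S.minExps x + weightAt (S.residualExps i) x := by
  have h := weightAt_eq_add_of_le (S.exps i) S.minExpAt (fun j => S.minExpAt_le i j) x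
  rw [mapIdx_eq_of_boundaryOf, S.boundaryOf_exps i] at h
  exact h

/-- A bare host has residual weight zero everywhere. [folklore] -/
theorem weightAt_residualExps_eq_zero_of_bare {i₀ : Fin S.n} (hbare : ∀ j, S.expAt i₀ j = S.minExpAt j) (x : X) :
    weightAt (S.residualExps i₀) x = 0 :=
  weightAt_eq_zero_of_forall_snd_eq_zero _ ((S.bare_iff_residualExps i₀).mp hbare) x

/-- [OURS · L1 W5.2 · X3 C-I · res-L1-w52-plan-1 G11-47 F-bare] **`residual_bare_step`: under a weight-one step that is legal for the
RESIDUAL (`1 ≤ m i + weightAt (residualExps i) η` for every summand — the step law's `hν` read on `S♭`, i.e. the centre's generic point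
lies in `cosupp K♭`) and gives the bare host order `1`, a BARE host stays BARE.**  (The one global carrier of idea-1's memo-3 (1) at every
stage.) [cite: BierstoneGrigorievMilmanWlodarczyk2011, §4 Step 2b] -/
theorem residual_bare_step [IsLocallyNoetherian X] (τ : X' ⟶ X) (W : Closeds X) (η : X) (m : Fin S.n → ℕ)
    (hsnc : HasSNCWith S.𝓔 (vanishingIdeal W)) (hτ : IsBlowup τ (vanishingIdeal W)) {i₀ : Fin S.n}
    (hbare : ∀ j, S.expAt i₀ j = S.minExpAt j) (hm₀ : m i₀ = 1) (hν : ∀ i, 1 ≤ m i + weightAt (S.residualExps i) η) (j : ℕ) :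
    (S.step τ W η m 1 hsnc hτ).expAt i₀ j = (S.step τ W η m 1 hsnc hτ).minExpAt j := by
  refine S.step_bare τ W η m 1 hsnc hτ hbare (fun i => ?_) j
  rw [hm₀, S.weightAt_exps_eq_add i₀ η, S.weightAt_exps_eq_add i η, S.weightAt_residualExps_eq_zero_of_bare hbare η, add_zero]
  have := hν i
  omega

/-- The same, read on the residual exponent list of the stepped state. [folklore] -/
theorem residual_bare_step' [IsLocallyNoetherian X] (τ : X' ⟶ X) (W : Closeds X) (η : X) (m : Fin S.n → ℕ)
    (hsnc : HasSNCWith S.𝓔 (vanishingIdeal W)) (hτ : IsBlowup τ (vanishingIdeal W)) {i₀ : Fin S.n}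
    (hbare : ∀ p ∈ S.residualExps i₀, p.2 = 0) (hm₀ : m i₀ = 1) (hν : ∀ i, 1 ≤ m i + weightAt (S.residualExps i) η) :
    ∀ p ∈ (S.step τ W η m 1 hsnc hτ).residualExps i₀, p.2 = 0 :=
  ((S.step τ W η m 1 hsnc hτ).bare_iff_residualExps i₀).mp
    (S.residual_bare_step τ W η m hsnc hτ ((S.bare_iff_residualExps i₀).mpr hbare) hm₀ hν)

end MultiHostState

end Summit.ResolutionOfSingularities.ResolutionOfSingularities.Theorems.DepthMultiHost

end
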